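import Literature.AlgebraicGeometry.Limits.LocalizationOpenDescent
import Literature.AlgebraicGeometry.Limits.SubalgebraDiagram
import Literature.AlgebraicGeometry.Motives.AbelianVarietyProofs
import Mathlib.AlgebraicGeometry.Morphisms.LocalFlatDescent
import HarnessLib

/-!
# Smoothness of relative dimension `n` descends along surjective (fpqc) base change

Topic `Literature/AlgebraicGeometry/Limits` (EGA IV₄ 17.7.4; Hartshorne III Prop. 10.1 (b); The Stacks
Project, Tag 02VL). Mathlib descends `Smooth` along fpqc covers (`DescendsAlong @Smooth`), but not the relative
dimension. This file supplies the missing (elementary) step and its form for the base-change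
functor `– ⊗ T` of the tree's limit library (`Limits/Localization*`, `Limits/Subalgebra*`):

* `smoothOfRelativeDimension_of_isPullback_of_denseRange` — **relative dimension is read off after a
  base change with dense image**: if `f : X → S` is smooth, `X' = X ×_S S' → S'` is smooth of
  relative dimension `n` and `X' → X` has dense image (e.g. `S' → S` surjective), then `f` is
  smooth of relative dimension `n` (the relative dimension of `f` is locally constant on `X` —
  `Motives.exists_opens_smoothOfRelativeDimension_of_smooth` — stable under base change, and unique on
  a non-empty scheme — `Motives.AbelianVarietyProofs.eq_of_smoothOfRelativeDimension`);
* `smoothOfRelativeDimension_whiskerRight_of_surjective` — **fpqc descent of "smooth of relative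
  dimension `n`" for `f ⊗ T`**: for `f : Q → P` over a base scheme and `g : T' → T` with `g`
  surjective, flat and quasi-compact, if `(f ⊗ T').left` is smooth of relative dimension `n` then
  so is `(f ⊗ T).left` (Mathlib's fpqc descent of smoothness on the cartesian square
  `LocApprox.isPullback_whiskerLeft_whiskerRight_left`, then the first result);
Everything is proved; no definitions, no named facts.

## References

* A. Grothendieck, J. Dieudonné, EGA IV₄, Publ. Math. IHÉS 32 (1967), Prop. 17.7.4. [EGAIV4]
* R. Hartshorne, *Algebraic Geometry* (1977), Ch. III Prop. 10.1 (b) (base extension preserves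
  "smooth of relative dimension `n`"). [Hartshorne1977]
* The Stacks Project, Tag 02VL (smoothness is fpqc local on the base). [StacksProject]
-/

noncomputable section

universe u

open CategoryTheory CategoryTheory.Limits AlgebraicGeometry TopologicalSpace MonoidalCategory

namespace Literature.AlgebraicGeometry.Limits

set_option backward.isDefEq.respectTransparency false

/-- **The relative dimension of a smooth morphism is detected after a base change with dense
image.** Let `(pr, f'; f, i)` be a cartesian square (`X' = X ×_S S'`, `pr : X' → X`, `f' : X' → S'`)
with `f` smooth, `f'` smooth of relative dimension `n` and `pr` of dense image. Then `f` is smooth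
of relative dimension `n`: near any `x ∈ X`, `f` is smooth of some relative dimension `d` on an open
`V ∋ x`; the non-empty open `pr⁻¹ V` of `X'` is then smooth of relative dimension `d` (base change)
and `n` (restriction) over `S'`, so `d = n` (Hartshorne III Prop. 10.1 (b): relative dimension
is preserved by base extension; EGA IV₄ 17.7.4 for the descent of smoothness itself).
[cite: Hartshorne1977, Ch. III Prop. 10.1 (b)] [cite: EGAIV4, Prop. 17.7.4] -/
theorem smoothOfRelativeDimension_of_isPullback_of_denseRange {X X' S S' : Scheme.{u}}
    {f : X ⟶ S} {f' : X' ⟶ S'} {pr : X' ⟶ X} {i : S' ⟶ S} (H : IsPullback pr f' f i)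
    [Smooth f] (n : ℕ) [hn : SmoothOfRelativeDimension n f'] (hpr : DenseRange pr.base) :
    SmoothOfRelativeDimension n f := by
  choose V d hxV hV using Literature.AlgebraicGeometry.Motives.exists_opens_smoothOfRelativeDimension_of_smooth f
  have hd : ∀ x, d x = n := fun x ↦ by
    obtain ⟨y, hy⟩ := hpr.exists_mem_open (V x).isOpen ⟨x, hxV x⟩
    haveI : Nonempty ((pr ⁻¹ᵁ V x : X'.Opens) : Scheme.{u}) := ⟨⟨y, hy⟩⟩
    have sq : IsPullback (pr ∣_ V x) ((pr ⁻¹ᵁ V x).ι ≫ f') ((V x).ι ≫ f) i :=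
      (isPullback_morphismRestrict pr (V x)).paste_vert H
    haveI := smoothOfRelativeDimension_isStableUnderBaseChange (n := d x)
    have h₁ : SmoothOfRelativeDimension (d x) ((pr ⁻¹ᵁ V x).ι ≫ f') :=
      MorphismProperty.of_isPullback sq (hV x)
    have h₂ : SmoothOfRelativeDimension n ((pr ⁻¹ᵁ V x).ι ≫ f') :=
      IsZariskiLocalAtSource.comp hn _
    exact Literature.AlgebraicGeometry.Motives.AbelianVarietyProofs.eq_of_smoothOfRelativeDimension _ h₁ h₂
  have hcov : iSup V = ⊤ := top_le_iff.mp fun x _ ↦ Opens.mem_iSup.mpr ⟨x, hxV x⟩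
  exact IsZariskiLocalAtSource.of_iSup_eq_top (P := @SmoothOfRelativeDimension n) V hcov
    fun x ↦ hd x ▸ hV x

/-- The surjective case: if `X' = X ×_S S'` with `S' → S` surjective, `f` smooth and `f'` smooth of
relative dimension `n`, then `f` is smooth of relative dimension `n`.
[cite: Hartshorne1977, Ch. III Prop. 10.1 (b)] [cite: EGAIV4, Prop. 17.7.4] -/
theorem smoothOfRelativeDimension_of_isPullback_of_surjective {X X' S S' : Scheme.{u}}
    {f : X ⟶ S} {f' : X' ⟶ S'} {pr : X' ⟶ X} {i : S' ⟶ S} (H : IsPullback pr f' f i)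
    [Smooth f] (n : ℕ) [SmoothOfRelativeDimension n f'] [Surjective i] :
    SmoothOfRelativeDimension n f := by
  haveI : Surjective pr := MorphismProperty.of_isPullback (P := @Surjective) H.flip inferInstance
  exact smoothOfRelativeDimension_of_isPullback_of_denseRange H n pr.surjective.denseRange

/-! ## The form for `f ⊗ T` -/

section Whisker

/-- `(P ⊗ T').left → (P ⊗ T).left` is the base change of `T'.left → T.left` along the projection
`(P ⊗ T).left → T.left` (the form of `SubalgApprox.isPullback_whiskerLeft_left` over an arbitrary base
scheme). [folklore] -/
private theorem isPullback_whiskerLeft_left_over {Y : Scheme.{u}} (P : Over Y) {T T' : Over Y}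
    (g : T' ⟶ T) :
    IsPullback (P ◁ g).left (pullback.snd P.hom T'.hom) (pullback.snd P.hom T.hom) g.left := by
  refine IsPullback.of_right ?_ (Over.whiskerLeft_left_snd g) (IsPullback.of_hasPullback P.hom T.hom)
  rw [Over.whiskerLeft_left_fst, Over.w g]
  exact IsPullback.of_hasPullback P.hom T'.hom

variable {Y : Scheme.{u}} {Q P : Over Y} (f : Q ⟶ P) (T : Over Y) {T' : Over Y} (g : T' ⟶ T)

/-- **fpqc descent of "smooth of relative dimension `n`" along `– ⊗ T' → – ⊗ T`.** For a morphism
`f : Q → P` over a base scheme and `g : T' → T` with `g.left` surjective, flat and quasi-compact: if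
`(f ⊗ T').left : (Q ⊗ T').left → (P ⊗ T').left` is smooth of relative dimension `n`, so is
`(f ⊗ T).left` — the square `Q ⊗ T' → P ⊗ T'` over `Q ⊗ T → P ⊗ T` is cartesian
(`LocApprox.isPullback_whiskerLeft_whiskerRight_left`), its bottom side is a base change of `g`,
smoothness descends (Mathlib `DescendsAlong @Smooth`), and the relative dimension is read off upstairs
(`smoothOfRelativeDimension_of_isPullback_of_surjective`). [cite: StacksProject, Tag 02VL]
[cite: EGAIV4, Prop. 17.7.4] -/
theorem smoothOfRelativeDimension_whiskerRight_of_surjective [Surjective g.left] [Flat g.left]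
    [QuasiCompact g.left] (n : ℕ) [SmoothOfRelativeDimension n (f ▷ T').left] :
    SmoothOfRelativeDimension n (f ▷ T).left := by
  have H := LocApprox.isPullback_whiskerLeft_whiskerRight_left f T g
  have HP := isPullback_whiskerLeft_left_over P g
  have HQ := isPullback_whiskerLeft_left_over Q g
  haveI : Surjective (P ◁ g).left :=
    MorphismProperty.of_isPullback (P := @Surjective) HP.flip inferInstance
  haveI : Flat (P ◁ g).left := MorphismProperty.of_isPullback (P := @Flat) HP.flip inferInstance
  haveI : QuasiCompact (P ◁ g).left :=
    MorphismProperty.of_isPullback (P := @QuasiCompact) HP.flip inferInstance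
  haveI : Surjective (Q ◁ g).left :=
    MorphismProperty.of_isPullback (P := @Surjective) HQ.flip inferInstance
  haveI : Smooth (f ▷ T').left := SmoothOfRelativeDimension.smooth n _
  have hcov : (@Surjective ⊓ @Flat ⊓ @QuasiCompact : MorphismProperty Scheme.{u}) (P ◁ g).left :=
    ⟨⟨inferInstance, inferInstance⟩, inferInstance⟩
  haveI : Smooth (f ▷ T).left :=
    MorphismProperty.of_isPullback_of_descendsAlong (P := @Smooth)
      (Q := @Surjective ⊓ @Flat ⊓ @QuasiCompact) H.flip hcov inferInstance
  exact smoothOfRelativeDimension_of_isPullback_of_denseRange H n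
    (Q ◁ g).left.surjective.denseRange

end Whisker

end Literature.AlgebraicGeometry.Limits

end
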